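import Literature.NumberTheory.EllipticCurves.OrdinaryNewformDatumExistsProofs
import Literature.NumberTheory.EllipticCurves.NewformPadicIntegralModel
import Literature.NumberTheory.EllipticCurves.CaiShuTian2014.HeegnerConditionProofs
import HarnessLib

/-!
# The ordinary `p`-adic data `(υ, ρ, Fil)` of an ordinary `Γ₀(M)`-newform EXISTS, granted Deligne's
# theorem and Hida's Thm. 3.26 (2) (proofs only; the `OrdinaryPadicData` currency)

A theorems-only companion (no definition, no named fact; D-0026) of
`NewformPadicIntegralModel.lean` (the data structure `OrdinaryPadicData g p ι` of the X11a chain of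
the BSD residual cell: a unit root `υ` of `X² − ι(a_p)X + p^{k−1}`, an integral model
`ρ : Γ_ℚ → GL₂(𝒪)` over `𝒪 = padicCoeffIntegers (memberGenerators g ι υ) = {x ∈ ℚ_p(ι K_g, υ) :
|x|_p ≤ 1} ⊂ ℚ̄_p` with `IsIntegralPadicModel g ι υ ρ`, and a `GreenbergSelmer.OrdinaryFiltration ρ v`
at the places `v ∋ p` — Emerton–Pollack–Weston, Invent. Math. 163 (2006), §3.1, p. 17, (eq:ordes)).
Its existence for an `ι`-ordinary newform is Hida, *Modular Forms and Galois Cohomology* (2000),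
Thm. 3.26 (1) (Shimura, Deligne) + (2) (Deligne, Mazur–Wiles; Wiles 1988 Thm. 2.2 / Thm. 2.1.4); the
chain's seat typed the instance it consumes as the named fact `exists_ordinaryPadicData_weightK_member`
(file `EmertonPollackWeston2006/WeightKMemberData.lean`, in review at the time of writing).  THIS
FILE PROVES that existence from the tree's two standing named facts — Deligne's theorem at the
finite places of the coefficient field (`ModularForms.DeligneSerre1974.thm61_exists_adicGaloisRep`)
and the `ℚ̄_p`-form of Hida's Thm. 3.26 (2) (`Hida2000_thm326_ordinary`) — exactly as the sibling
file `OrdinaryNewformDatumExistsProofs.lean` does for the `OrdinaryNewformDatum` currency, whose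
`λ`-adic integral model with integral ordinary frames
(`GreenbergSelmer.exists_framedGaloisRep_adicCompletionIntegers_integralFrame`) and transport lemmas
it reuses:

* `OrdinaryPadicData.exists_unitRoot` — `|a| = 1`, `|c| < 1` ⇒ `X² − aX + c` has a root of norm `1`
  in `ℚ̄_p` (algebraically closed + ultrametric; elementary).
* `OrdinaryPadicData.nonempty_of_thm61_of_thm326_of_unitRoot` — for a newform `g ∈ S_k(Γ₀(M))`,
  `k ≥ 2`, `p ∤ M`, `ι : K_g → ℚ̄_p` with `|ι(a_p(g))|_p = 1` and a GIVEN unit root `υ`: a datum with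
  `𝔇.υ = υ`.  The transport `e : 𝒪_v → 𝒪` is the continuous extension `φ_j` of `j = ι|_{K₁}`
  (`ParallelWeight.padicPlaceHom`, Neukirch II §8), which lands in `ℚ_p(ι K_g, υ)` (closed, being
  finite-dimensional: `K_g` is a number field — Deligne–Serre (2.7.3), proved in the tree — and `υ`
  is algebraic) and is integral on `𝒪_v`.
* `OrdinaryPadicData.nonempty_of_thm61_of_thm326` — the same with `υ` supplied by `exists_unitRoot`.
* `exists_ordinaryPadicData_weightK_member_of_thm61_of_thm326` — the BODY of the chain's named fact
  (E1) `exists_ordinaryPadicData_weightK_member` (every ordinary weight-`k` member `(g, ι)` of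
  `H(E[p])` at a multiplicative prime `p ≥ 5` of `E` has ordinary `p`-adic data), granted the two
  facts; `p ∤ N/p` because `p ‖ N` at a multiplicative prime.

Net debt: 0 (no `def … : Prop`); the two deep inputs enter as hypotheses by name.

## References

* H. Hida, *Modular Forms and Galois Cohomology*, CUP (2000), Thm. 3.26 (1)–(2), pp. 151–152.
  [Hida2000]
* M. Emerton, R. Pollack, T. Weston, *Variation of Iwasawa invariants in Hida families*, Invent.
  Math. 163 (2006), §3.1 (p. 17). [EmertonPollackWeston2006]
* A. Wiles, *On ordinary `λ`-adic representations associated to modular forms*, Invent. Math. 94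
  (1988), Thm. 2.1.4 (p. 561), pp. 562–563, Thm. 2.2. [Wiles1988]
* P. Deligne, J.-P. Serre, *Formes modulaires de poids 1*, Ann. Sci. ÉNS 7 (1974), Thm. 6.1.
  [DeligneSerreASENS1974]
* J. Neukirch, *Algebraic Number Theory* (1999), Ch. II §8 (pp. 160–161). [NeukirchANT1999]
* J. H. Silverman, *Advanced Topics in the Arithmetic of Elliptic Curves*, GTM 151 (1994),
  IV.10.2(b) (conductor exponent `1` at a multiplicative prime). [Silverman1994]
-/

noncomputable section

open scoped MatrixGroups Matrix ModularForm NumberField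

open NumberField IsDedekindDomain Field CongruenceSubgroup UpperHalfPlane Rat.HeightOneSpectrum
  Polynomial
open Literature.NumberTheory.GaloisRepresentations
open Literature.NumberTheory.EllipticCurves.ModularForms

namespace Literature.NumberTheory.EllipticCurves

namespace OrdinaryPadicData

/-! ## §1. The unit root in `ℚ̄_p` -/

/-- **The unit root in `ℚ̄_p`**: for `|a| = 1` and `|c| < 1` the polynomial `X² − aX + c` has a root
of norm `1` in `ℚ̄_p` (algebraically closed; the two roots have product `c` and sum `a`, so by the
ultrametric inequality exactly one of them is a unit).  Applied to `a = ι(a_p(g))`, `c = p^{k−1}`,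
this is `α(𝔭, f)`, "the unit root of `x² − c(𝔭,f)x + ψ(𝔭)N𝔭^{k−1}`" of Wiles's Thm. 2.1.4 — the
`U_p`-eigenvalue of the ordinary `p`-stabilisation (Emerton–Pollack–Weston §3.1); the same elementary
lemma is proved on the summit side in `X11a/ChainSocket.lean`.
[cite: Wiles1988, Thm. 2.1.4 (p. 561)] [cite: EmertonPollackWeston2006, §3.1 (arXiv:math/0404484 p. 17)] -/
theorem exists_unitRoot (p : ℕ) [Fact p.Prime] {a c : PadicAlgCl p} (ha : ‖a‖ = 1) (hc : ‖c‖ < 1) :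
    ∃ υ : PadicAlgCl p, υ ^ 2 - a * υ + c = 0 ∧ ‖υ‖ = 1 := by
  -- a root `υ₁` of the monic quadratic over the algebraically closed field `ℚ̄_p`
  have hdeg : (X ^ 2 - C a * X + C c : (PadicAlgCl p)[X]).degree = 2 := by
    have h : (X ^ 2 - C a * X + C c : (PadicAlgCl p)[X]) = X ^ 2 + C (-a) * X + C c := by
      simp only [map_neg, neg_mul, sub_eq_add_neg]
    rw [h]
    compute_degree!
  obtain ⟨υ₁, hυ₁⟩ : ∃ x, (X ^ 2 - C a * X + C c : (PadicAlgCl p)[X]).IsRoot x :=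
    IsAlgClosed.exists_root _ (by rw [hdeg]; norm_num)
  have h1 : υ₁ ^ 2 - a * υ₁ + c = 0 := by
    have h := hυ₁.eq_zero
    simp only [eval_add, eval_sub, eval_pow, eval_X, eval_mul, eval_C] at h
    exact h
  -- the other root `υ₂ = a − υ₁`: `υ₁ + υ₂ = a`, `υ₁ υ₂ = c`
  have h2 : (a - υ₁) ^ 2 - a * (a - υ₁) + c = 0 := by linear_combination h1
  have hprod : ‖υ₁‖ * ‖a - υ₁‖ < 1 := by
    rw [← norm_mul, show υ₁ * (a - υ₁) = c by linear_combination -h1]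
    exact hc
  have hsum : υ₁ + (a - υ₁) = a := by ring
  by_cases hυ₁1 : ‖υ₁‖ = 1
  · exact ⟨υ₁, h1, hυ₁1⟩
  by_cases hυ₂1 : ‖a - υ₁‖ = 1
  · exact ⟨a - υ₁, h2, hυ₂1⟩
  exfalso
  -- both norms `≠ 1` with product `< 1`: if they differ, `|a| = max` is `≠ 1`; if equal, both `< 1`
  have hmax : ‖a‖ ≤ max ‖υ₁‖ ‖a - υ₁‖ := by
    have h := IsUltrametricDist.norm_add_le_max υ₁ (a - υ₁)
    rwa [hsum] at h
  rw [ha] at hmax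
  by_cases hne : ‖υ₁‖ = ‖a - υ₁‖
  · -- equal norms `r` with `r² < 1` force `r < 1`, contradicting `1 ≤ max r r = r`
    rw [← hne, max_self] at hmax
    rw [← hne] at hprod
    nlinarith [norm_nonneg υ₁]
  · have heq := IsUltrametricDist.norm_add_eq_max_of_norm_ne_norm hne
    rw [hsum, ha] at heq
    -- `1 = max`, so one of the two norms is `1`: contradiction
    rcases max_choice ‖υ₁‖ ‖a - υ₁‖ with h | h
    · exact hυ₁1 (h ▸ heq).symm
    · exact hυ₂1 (h ▸ heq).symm

/-! ## §2. The datum over `𝒪 = {x ∈ ℚ_p(ι K_g, υ) : |x| ≤ 1}` -/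

section GammaZero

variable {M : ℕ} [NeZero M] {k : ℤ}

/-- **The ordinary `p`-adic data of an ordinary `Γ₀(M)`-newform exist, for a given unit root,
granted Deligne's theorem and Hida's Thm. 3.26 (2).**  For a newform `g ∈ S_k(Γ₀(M))`, `k ≥ 2`, a
prime `p ∤ M`, `ι : K_g → ℚ̄_p` with `|ι(a_p(g))|_p = 1`, and `υ ∈ ℚ̄_p` with
`υ² − ι(a_p)υ + p^{k−1} = 0`, `|υ| = 1`: there is `𝔇 : OrdinaryPadicData g p ι` with `𝔇.υ = υ`.
(i) `g₁ = liftToGamma1 g` is a `Γ₁(M)`-newform with the same `q`-expansion and trivial character;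
`K₁ = ℚ(a_n, ε) ⊆ K_g` is a number field and `j := ι|_{K₁}` cuts out a place `v ∋ p` with
`v(a_p) = 1` (`ParallelWeight.padicPlace`); (ii) the sibling file's
`exists_framedGaloisRep_adicCompletionIntegers_integralFrame` gives `ρ_v : Γ_ℚ → GL₂(𝒪_v)` attached
to `g₁` with integral ordinary frames at every `w ∋ p` (Deligne + Serre's lattice + Hida 3.26 (2) +
Wiles's lattice step); (iii) the continuous extension `φ_j : (K₁)_v → ℚ̄_p` of `j` takes values in
`K = ℚ_p(ι K_g, υ)` (closed: finite-dimensional — `K_g` a number field by Deligne–Serre (2.7.3), `υ`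
algebraic) and maps `𝒪_v` into `𝒪 = {|x| ≤ 1}`, giving a continuous `e : 𝒪_v → 𝒪 ⊂ ℚ̄_p` and
`ρ := ρ_v ⊗_e 𝒪`; (iv) `IsIntegralPadicModel`: unramified at `ℓ ∤ Mp` (transport both ways), and
`P := charpoly ρ(σ₀)` of one arithmetic Frobenius maps to `X² − ι(a_ℓ)X + ℓ^{k−1}` in `ℚ̄_p[X]`
(`map_charpoly_baseChange_eq`, `φ_j ∘ (K₁ → (K₁)_v) = j`, trivial nebentypus), hence is the
characteristic polynomial of every Frobenius at `ℓ` (`𝒪 → ℚ̄_p` injective); (v) the frames transport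
(`integralFrame_baseChange`) and give the filtrations (`OrdinaryFiltration.exists_ofIntegralFrame`).
[cite: Hida2000, Thm. 3.26 (1)–(2), pp. 151–152] [cite: EmertonPollackWeston2006, §3.1 (p. 17), (eq:ordes)]
[cite: Wiles1988, Thm. 2.1.4 (p. 561), pp. 562–563] [cite: NeukirchANT1999, Ch. II §8 (pp. 160–161)] -/
theorem nonempty_of_thm61_of_thm326_of_unitRoot
    (h61 : DeligneSerre1974.thm61_exists_adicGaloisRep) (h : Hida2000_thm326_ordinary)
    (g : CuspForm (Gamma0 M) k) (hg : IsNewform0 g) (hk : 2 ≤ k) (p : ℕ) [Fact p.Prime]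
    (hpM : ¬ p ∣ M) (ι : coeffField g →+* PadicAlgCl p)
    (hord : ‖ι ⟨(qExpansion 1 ⇑g).coeff p, coeff_mem_coeffField g p⟩‖ = 1)
    {υ : PadicAlgCl p}
    (hυ : υ ^ 2 - ι ⟨(qExpansion 1 ⇑g).coeff p, coeff_mem_coeffField g p⟩ * υ +
      (p : PadicAlgCl p) ^ (k - 1).toNat = 0)
    (hυ1 : ‖υ‖ = 1) :
    ∃ 𝔇 : OrdinaryPadicData g p ι, 𝔇.υ = υ := by
  classical
  have hp : p.Prime := Fact.out
  /- (i) the `Γ₁`-lift, its coefficient field `K₁`, `j = ι|_{K₁}` -/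
  have hg1 : IsNewform1 (liftToGamma1 M k g) := (isNewform1_liftToGamma1_iff_holds M k g).mpr hg
  have hg0 : g ≠ 0 := by
    intro h0
    have h1 : IsNormalized g := hg.2.2
    rw [IsNormalized, h0] at h1
    simp [UpperHalfPlane.qExpansion_zero] at h1
  have hcoe : (⇑(liftToGamma1 M k g) : ℍ → ℂ) = ⇑g := coe_liftToGamma1_holds M k g
  have hε : nebentypus (liftToGamma1 M k g) = 1 := nebentypus_liftToGamma1_holds M k hg0
  haveI : NumberField (coeffCharField (liftToGamma1 M k g)) :=
    GreenbergSelmer.numberField_coeffCharField_liftToGamma1 hg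
  have hle : coeffCharField (liftToGamma1 M k g) ≤ coeffField g :=
    GreenbergSelmer.coeffCharField_liftToGamma1_le hg0
  set j : coeffCharField (liftToGamma1 M k g) →+* PadicAlgCl p :=
    ι.comp (IntermediateField.inclusion hle).toRingHom with hj
  have hjval : ∀ x : coeffCharField (liftToGamma1 M k g),
      j x = ι (IntermediateField.inclusion hle x) := fun x ↦ rfl
  have hjn : ∀ n : ℕ,
      j ⟨(qExpansion 1 ⇑(liftToGamma1 M k g)).coeff n,
        cuspCoeff_mem_coeffCharField (liftToGamma1 M k g) n⟩ =
      ι ⟨(qExpansion 1 ⇑g).coeff n, coeff_mem_coeffField g n⟩ := by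
    intro n
    have hval : (((IntermediateField.inclusion hle)
        ⟨(qExpansion 1 ⇑(liftToGamma1 M k g)).coeff n,
          cuspCoeff_mem_coeffCharField (liftToGamma1 M k g) n⟩ : coeffField g) : ℂ) =
        (qExpansion 1 ⇑g).coeff n := by
      rw [IntermediateField.coe_inclusion]
      change (qExpansion 1 ⇑(liftToGamma1 M k g)).coeff n = (qExpansion 1 ⇑g).coeff n
      rw [hcoe]
    rw [hjval]
    exact congrArg ι (Subtype.ext hval)
  /- the place `v = v(j)` and `φ = φ_j` -/
  set v : HeightOneSpectrum (𝓞 (coeffCharField (liftToGamma1 M k g))) :=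
    Automorphic.ParallelWeight.padicPlace (coeffCharField (liftToGamma1 M k g)) p j with hv
  have hpv : ((p : ℕ) : 𝓞 (coeffCharField (liftToGamma1 M k g))) ∈ v.asIdeal :=
    Automorphic.ParallelWeight.natCast_mem_padicPlace _ p j
  have hjv : ∀ r : 𝓞 (coeffCharField (liftToGamma1 M k g)), Valued.v (j r) < 1 ↔ r ∈ v.asIdeal :=
    Automorphic.ParallelWeight.valued_lt_one_iff_mem_padicPlace _ p j
  set φ := Automorphic.ParallelWeight.padicPlaceHom (coeffCharField (liftToGamma1 M k g)) p j with hφ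
  have hφc : Continuous φ := Automorphic.ParallelWeight.continuous_padicPlaceHom _ p j
  have hφj : ∀ x, φ (algebraMap _ _ x) = j x :=
    Automorphic.ParallelWeight.padicPlaceHom_algebraMap _ p j
  -- `v(a_p) = 1`
  have hval1 : Valued.v (j ⟨(qExpansion 1 ⇑(liftToGamma1 M k g)).coeff p,
      cuspCoeff_mem_coeffCharField (liftToGamma1 M k g) p⟩) = 1 := by
    rw [hjn p, PadicAlgCl.valuation_def, ← NNReal.coe_inj, coe_nnnorm, NNReal.coe_one]
    exact hord
  have hordv : v.valuation (coeffCharField (liftToGamma1 M k g))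
      ⟨(qExpansion 1 ⇑(liftToGamma1 M k g)).coeff p,
        cuspCoeff_mem_coeffCharField (liftToGamma1 M k g) p⟩ = 1 :=
    (valued_eq_one_iff_valuation_eq_one j v hpv hjv _).mp hval1
  /- (ii) the `λ`-adic integral model with integral ordinary frames -/
  obtain ⟨ρv, hρv, hframe⟩ :=
    GreenbergSelmer.exists_framedGaloisRep_adicCompletionIntegers_integralFrame
      h61 h hk hg1 v hp hpv hpM hordv
  /- (iii) `K = ℚ_p(ι K_g, υ)` is finite-dimensional, hence closed; `φ` lands in `K`, integrally -/
  haveI hfdKg : FiniteDimensional ℚ (coeffField g) := by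
    have h1 : FiniteDimensional ℚ (coeffField (liftToGamma1 M k g)) :=
      (IsNewform1.finiteDimensional_coeffField_of_span_integralLattice1
        (DeligneSerre1974_span_integralLattice1_holds M k)) hg1
    have h2 : coeffField (liftToGamma1 M k g) = coeffField g := by
      unfold coeffField
      rw [hcoe]
    rwa [h2] at h1
  haveI : NumberField (coeffField g) := NumberField.mk
  obtain ⟨L, hLfd, hιL⟩ := exists_intermediateField_finiteDimensional_range_subset ι
  haveI := hLfd
  have hυint : IsIntegral ℚ_[p] υ := (Algebra.IsAlgebraic.isAlgebraic (R := ℚ_[p]) υ).isIntegral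
  haveI : FiniteDimensional ℚ_[p] (IntermediateField.adjoin ℚ_[p] {υ}) :=
    IntermediateField.adjoin.finiteDimensional hυint
  have hKL : padicCoeffField (memberGenerators g ι υ) ≤ L ⊔ IntermediateField.adjoin ℚ_[p] {υ} := by
    refine IntermediateField.adjoin_le_iff.mpr ?_
    change Set.range ι ∪ {υ} ⊆ _
    refine Set.union_subset (Set.range_subset_iff.mpr fun x ↦ ?_)
      (Set.singleton_subset_iff.mpr ?_)
    · exact (le_sup_left : L ≤ L ⊔ IntermediateField.adjoin ℚ_[p] {υ}) (hιL x)
    · exact (le_sup_right : IntermediateField.adjoin ℚ_[p] {υ} ≤ L ⊔ IntermediateField.adjoin ℚ_[p] {υ})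
        (IntermediateField.mem_adjoin_simple_self ℚ_[p] υ)
  haveI hfdK : FiniteDimensional ℚ_[p] (padicCoeffField (memberGenerators g ι υ)) :=
    FiniteDimensional.of_injective (IntermediateField.inclusion hKL).toLinearMap
      (IntermediateField.inclusion_injective hKL)
  have hKclosed : IsClosed ((padicCoeffField (memberGenerators g ι υ) :
      IntermediateField ℚ_[p] (PadicAlgCl p)) : Set (PadicAlgCl p)) :=
    Automorphic.ParallelWeight.isClosed_intermediateField p (padicCoeffField (memberGenerators g ι υ))
  have hφK : ∀ y, φ y ∈ padicCoeffField (memberGenerators g ι υ) := by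
    intro y
    refine Automorphic.ParallelWeight.padicPlaceHom_mem_of_forall_mem _ p j hKclosed (fun x ↦ ?_) y
    rw [SetLike.mem_coe, hjval]
    exact IntermediateField.subset_adjoin ℚ_[p] _ (Or.inl (Set.mem_range_self _))
  have hφint : ∀ y : v.adicCompletionIntegers (coeffCharField (liftToGamma1 M k g)),
      ‖φ (y : v.adicCompletion (coeffCharField (liftToGamma1 M k g)))‖ ≤ 1 := by
    intro y
    have hy : Valued.v (y : v.adicCompletion (coeffCharField (liftToGamma1 M k g))) ≤ 1 :=
      (HeightOneSpectrum.mem_adicCompletionIntegers (𝓞 _) _ _).1 y.2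
    have h1 :=
      Automorphic.ParallelWeight.valued_padicPlaceHom_le_one (coeffCharField (liftToGamma1 M k g)) p j hy
    rwa [PadicAlgCl.valuation_def, ← NNReal.coe_le_coe, coe_nnnorm, NNReal.coe_one] at h1
  -- the continuous ring homomorphism `e : 𝒪_v → 𝒪 ⊂ ℚ̄_p`
  let e : v.adicCompletionIntegers (coeffCharField (liftToGamma1 M k g)) →+*
      padicCoeffIntegers (memberGenerators g ι υ) :=
    (φ.comp (v.adicCompletionIntegers (coeffCharField (liftToGamma1 M k g))).subtype).codRestrict
      (padicCoeffIntegers (memberGenerators g ι υ)) fun y ↦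
        (mem_padicCoeffIntegers_iff _ _).mpr ⟨hφK y, hφint y⟩
  have he : Continuous e := continuous_induced_rng.2 (hφc.comp continuous_subtype_val)
  have heinj : Function.Injective (padicCoeffIntegers (memberGenerators g ι υ)).subtype :=
    fun x y hxy ↦ Subtype.ext hxy
  have hsq : ∀ y : v.adicCompletionIntegers (coeffCharField (liftToGamma1 M k g)),
      (padicCoeffIntegers (memberGenerators g ι υ)).subtype (e y) =
        φ ((v.adicCompletionIntegers (coeffCharField (liftToGamma1 M k g))).subtype y) :=
    fun _ ↦ rfl
  /- the representation -/
  let ρ : FramedGaloisRep ℚ (padicCoeffIntegers (memberGenerators g ι υ)) 2 :=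
    FramedRep.baseChange e he ρv
  /- (v) filtrations at the places above `p` -/
  have hfil : ∀ w : HeightOneSpectrum (𝓞 ℚ), ((p : ℕ) : 𝓞 ℚ) ∈ w.asIdeal →
      ∃ P : GreenbergSelmer.OrdinaryFiltration ρ w, True := by
    intro w hw
    obtain ⟨Q₀, hQ₀⟩ := hframe hw
    obtain ⟨P, -⟩ := GreenbergSelmer.OrdinaryFiltration.exists_ofIntegralFrame ρ w
      (Matrix.GeneralLinearGroup.map e Q₀)
      (fun σ ↦ (GreenbergSelmer.integralFrame_baseChange e he ρv w Q₀ (fun σ ↦ (hQ₀ σ).1)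
        (fun σ hσ ↦ (hQ₀ σ).2 hσ) σ).1)
      (fun σ hσ ↦ (GreenbergSelmer.integralFrame_baseChange e he ρv w Q₀ (fun σ ↦ (hQ₀ σ).1)
        (fun σ hσ ↦ (hQ₀ σ).2 hσ) σ).2 hσ)
    exact ⟨P, trivial⟩
  /- (iv) `IsIntegralPadicModel`, and assembly -/
  refine ⟨{ υ := υ
            υ_root := hυ
            norm_υ := hυ1
            ρ := ρ
            isModel := ?_
            fil := fun w hw ↦ (hfil w hw).choose }, rfl⟩
  intro v' hℓ
  have hℓprime : ((primesEquiv v' : Nat.Primes) : ℕ).Prime := (primesEquiv v').2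
  have hℓM : ¬ ((primesEquiv v' : Nat.Primes) : ℕ) ∣ M := fun h1 ↦ hℓ (h1.mul_right p)
  have hv'S : ((primesEquiv v' : Nat.Primes) : ℕ) ∉ {q | q ∣ M * p} := hℓ
  obtain ⟨hur, hchar⟩ := hρv v' hv'S
  -- unramified
  have hurv : ρv.IsUnramifiedAt v' :=
    GreenbergSelmer.isUnramifiedAt_of_baseChange_injective _ continuous_subtype_val
      Subtype.val_injective hur
  refine ⟨GreenbergSelmer.isUnramifiedAt_baseChange e he hurv, ?_⟩
  -- the Frobenius polynomial: the image in `ℚ̄_p[X]` of `charpoly ρ(σ)` is `X² − ι(a_ℓ)X + ℓ^{k-1}`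
  have htarget : ∀ σ : absoluteGaloisGroup ℚ, (∃ 𝔓 ∈ v'.primesAbove, IsArithFrobAt (𝓞 ℚ) σ 𝔓) →
      (FramedRep.charpoly ρ σ).map (padicCoeffIntegers (memberGenerators g ι υ)).subtype =
        X ^ 2 - C (ι ⟨(qExpansion 1 ⇑g).coeff ((primesEquiv v' : Nat.Primes) : ℕ),
          coeff_mem_coeffField g _⟩) * X +
          C ((((primesEquiv v' : Nat.Primes) : ℕ) : PadicAlgCl p) ^ (k - 1).toNat) := by
    rintro σ ⟨𝔓, h𝔓, hσ⟩
    rw [GreenbergSelmer.map_charpoly_baseChange_eq e he _ continuous_subtype_val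
      (padicCoeffIntegers (memberGenerators g ι υ)).subtype φ hsq ρv σ, hchar 𝔓 h𝔓 σ hσ,
      Polynomial.map_map,
      show φ.comp (algebraMap (coeffCharField (liftToGamma1 M k g))
        (v.adicCompletion (coeffCharField (liftToGamma1 M k g)))) = j from RingHom.ext hφj,
      GreenbergSelmer.map_heckePolynomial_of_nebentypus_eq_one hε (by omega)
        ((Nat.Prime.coprime_iff_not_dvd hℓprime).mpr hℓM) j, hjn]
  -- choose one arithmetic Frobenius to name `P`
  obtain ⟨𝔓₀, h𝔓₀⟩ := v'.primesAbove_nonempty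
  obtain ⟨σ₀, hσ₀⟩ := HeightOneSpectrum.exists_isArithFrobAt_of_mem_primesAbove_holds h𝔓₀
  refine ⟨FramedRep.charpoly ρ σ₀, htarget σ₀ ⟨𝔓₀, h𝔓₀, hσ₀⟩, fun 𝔓 h𝔓 σ hσ ↦ ?_⟩
  apply Polynomial.map_injective (padicCoeffIntegers (memberGenerators g ι υ)).subtype heinj
  rw [htarget σ ⟨𝔓, h𝔓, hσ⟩, htarget σ₀ ⟨𝔓₀, h𝔓₀, hσ₀⟩]

/-- **The ordinary `p`-adic data of an ordinary `Γ₀(M)`-newform exist, granted Deligne's theorem and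
Hida's Thm. 3.26 (2)**: `Nonempty (OrdinaryPadicData g p ι)` for a newform `g ∈ S_k(Γ₀(M))`,
`k ≥ 2`, `p ∤ M`, `ι : K_g → ℚ̄_p` with `|ι(a_p(g))|_p = 1` — the unit root from `exists_unitRoot`
(`|p^{k−1}| < 1` as `k ≥ 2`), the rest from `nonempty_of_thm61_of_thm326_of_unitRoot`.
[cite: Hida2000, Thm. 3.26 (1)–(2), pp. 151–152] [cite: EmertonPollackWeston2006, §3.1 (p. 17), (eq:ordes)]
[cite: Wiles1988, Thm. 2.2] -/
theorem nonempty_of_thm61_of_thm326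
    (h61 : DeligneSerre1974.thm61_exists_adicGaloisRep) (h : Hida2000_thm326_ordinary)
    (g : CuspForm (Gamma0 M) k) (hg : IsNewform0 g) (hk : 2 ≤ k) (p : ℕ) [Fact p.Prime]
    (hpM : ¬ p ∣ M) (ι : coeffField g →+* PadicAlgCl p)
    (hord : ‖ι ⟨(qExpansion 1 ⇑g).coeff p, coeff_mem_coeffField g p⟩‖ = 1) :
    Nonempty (OrdinaryPadicData g p ι) := by
  have hp : p.Prime := Fact.out
  have hc : ‖((p : PadicAlgCl p)) ^ (k - 1).toNat‖ < 1 := by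
    have hk1 : (k - 1).toNat ≠ 0 := by omega
    rw [norm_pow]
    refine pow_lt_one₀ (norm_nonneg _) ?_ hk1
    have hv := PadicAlgCl.valuation_p p
    rw [PadicAlgCl.valuation_def] at hv
    rw [← coe_nnnorm, hv, NNReal.coe_div, NNReal.coe_one, NNReal.coe_natCast]
    exact (div_lt_one (by exact_mod_cast hp.pos)).mpr (by exact_mod_cast hp.one_lt)
  obtain ⟨υ, hυ, hυ1⟩ := exists_unitRoot p hord hc
  obtain ⟨𝔇, -⟩ := nonempty_of_thm61_of_thm326_of_unitRoot h61 h g hg hk p hpM ι hord hυ hυ1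
  exact ⟨𝔇⟩

end GammaZero

end OrdinaryPadicData

/-! ## §3. The instance consumed by the X11a chain: ordinary members of `H(E[p])` -/

/-- At a multiplicative prime `p` of a globally minimal `E/ℚ` the conductor exponent is `1`
(`p ‖ N`: the tree's `factorization_conductorNorm_eq_one_of_hasMultiplicativeReductionAtPrime`), so
`p ∤ N/p`. [cite: Silverman1994, IV.10.2(b)] -/
theorem not_dvd_conductorNorm_div_of_hasMultiplicativeReductionAtPrime (W : WeierstrassCurve ℚ)
    [W.IsElliptic] (p : ℕ) [Fact p.Prime]
    (hmult : W.HasMultiplicativeReductionAtPrime p) : ¬ p ∣ W.conductorNorm ℤ / p := by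
  have hp : p.Prime := Fact.out
  have hN : W.conductorNorm ℤ ≠ 0 := (W.conductorNorm_pos_holds).ne'
  have hfac := W.factorization_conductorNorm_eq_one_of_hasMultiplicativeReductionAtPrime p hmult
  have hdvd : p ∣ W.conductorNorm ℤ := (hp.dvd_iff_one_le_factorization hN).mpr hfac.ge
  intro h
  have h2 : p ^ 2 ∣ W.conductorNorm ℤ := by
    rw [pow_two]
    exact Nat.mul_dvd_of_dvd_div hdvd h
  have := (hp.pow_dvd_iff_le_factorization hN).mp h2
  omega

/-- **(E1) of the X11a chain, granted Deligne's theorem and Hida's Thm. 3.26 (2)** — the BODY of the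
named fact `exists_ordinaryPadicData_weightK_member` (Emerton–Pollack–Weston §3.1 instance: every
ordinary weight-`k` member `(g, ι)` of the Hida family `H(E[p])` of a globally minimal `E/ℚ` at a
multiplicative prime `p ≥ 5` with `E[p]` irreducible has ordinary `p`-adic data), PROVED from
`DeligneSerre1974.thm61_exists_adicGaloisRep` and `Hida2000_thm326_ordinary`: `IsOrdinaryMemberOf`
supplies `2 < k`, `IsNewform0 g` and `|ι(a_p(g))|_p = 1`, and `p ∤ N/p` at a multiplicative prime;
the hypotheses `5 ≤ p` and irreducibility are not used.
[cite: EmertonPollackWeston2006, §3.1 (arXiv:math/0404484 p. 17), (eq:ordes)]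
[cite: Hida2000, Thm. 3.26 (1)–(2), pp. 151–152] [cite: Wiles1988, Thm. 2.2] -/
theorem exists_ordinaryPadicData_weightK_member_of_thm61_of_thm326
    (h61 : DeligneSerre1974.thm61_exists_adicGaloisRep) (h : Hida2000_thm326_ordinary)
    (W : WeierstrassCurve ℚ) [W.IsElliptic] [W.IsGloballyMinimal] (p : ℕ) [Fact p.Prime]
    (_hp5 : 5 ≤ p) (hmult : W.HasMultiplicativeReductionAtPrime p)
    (_hirr : W.HasIrreducibleModPGaloisRep p) [NeZero (W.conductorNorm ℤ / p)] {k : ℤ}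
    (g : CuspForm (Gamma0 (W.conductorNorm ℤ / p)) k) (ι : coeffField g →+* PadicAlgCl p)
    (hmem : IsOrdinaryMemberOf W p g ι) : Nonempty (OrdinaryPadicData g p ι) :=
  OrdinaryPadicData.nonempty_of_thm61_of_thm326 h61 h g hmem.2.2.1 (by have := hmem.1; omega) p
    (not_dvd_conductorNorm_div_of_hasMultiplicativeReductionAtPrime W p hmult) ι hmem.2.2.2.1

end Literature.NumberTheory.EllipticCurves

end
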